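/-
Copyright (c) 2026 the pub-hodgecm-mathlib formalisation cell (harness21).  Prover seat hodgecm-mathlib-K2E4-p11 (g8): Track B «K2-LIT»,
#184♮ = hLiu418 = stmt-HodgeConjecture-24832; socket #41 open surface (u-0c), I4 block (desk of record): ALL CONSTRUCTIBLE datum letters of ★ p862751 I4 ED. 5
in ONE `obtain` for the TOP's tie (LEAD F0P6-plan (g14) BATCH #114 (2); consumer K2E3-typ2's #41 v14 at ED. 17).
THEOREMS ONLY (no `def`, no `instance`, no `notation`, no named-fact hypothesis, no `sorry`).
-/
import Summits.HodgeConjecture.HodgeConjecture.Theorems.K2LiuSiegelMiddleTermStabilizerWeight   -- ★ p862779 (this seat): `exists_stabilizer_coveringWeight`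
import Summits.HodgeConjecture.HodgeConjecture.Theorems.K2LiuSiegelDoubledLeviMatrix            -- ★ `exists_leviHom` (the chart's `Λ`, continuous, `hΛ`)
import Summits.HodgeConjecture.HodgeConjecture.Theorems.K2LiuSiegelMiddleCellSortedPattern      -- ★ α2b `exists_reflStd` (the middle reflection `g₀`)
import Summits.HodgeConjecture.HodgeConjecture.Theorems.K2LiuSiegelBruhatMiddleCellDelta        -- ★ `iotaGG_one_mem_ratH` (`w₀ ∈ H(L⁺)`)
import HarnessLib

/-!
# Crux `HLiu418`, socket #41, (u-0c) I4 block — `K2LiuSiegelMiddleTermDatumLetters`: THE CONSTRUCTIBLE DATUM LETTERS `g₀ hg₀ Λ hΛc hΛ Γ₀ hΓ₀ β₁ hβ₁ F hF` OF I4 ED. 5,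
# IN ONE EXISTENTIAL

Cell `hodgecm-mathlib`, crux item hLiu418 = `stmt-HodgeConjecture-24832`; squad K2 ∕ K2Liu (L1, LEAD F0P6-plan (g14)), road `K2_Liu`, socket #41, (u-0c) I4 block
(K2E4-p11 desk of record; consumer = the TOP's tie of ★ ED. 17 `siegelEisensteinContinuation_seventeen` ∕ K2E3-typ2's v14).  Lane `--supports stmt-HodgeConjecture-24832 --as helper`
(count-neutral helper; closes no socket by itself).  FRAME `e : Fin N × Fin M ≃ Fin 2` LITERAL (= ★ p862751 ED. 5's frame).

THE MATHEMATICS [MoeglinWaldspurger1995, II.1.6–II.1.7], [GelbartPiatetskishapiroRallis1987, Part A §1], [KudlaRallis1994, §2].  The middle-cell datum of ★ α3-2 ∕ ★ I4 ED. 5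
consists of the middle reflection `g₀` (`g₀ = diag(1 − 2·𝟙_{e⁻¹(1)})`, ★ `exists_reflStd`), the Levi chart `Λ : GL₂(𝔸_L) →* H(𝔸)` (continuous, with the block equation `hΛ`,
★ `exists_leviHom`), the stabiliser lattice `Γ₀ = {u ∈ N_Δ(L⁺) | w₀ u w₀⁻¹ ∈ P_Δ}` of `w₀ = ι(1, g₀ ⊗ 1)` with a `Γ₀`-covering weight `β₁` (★ p862779
`exists_stabilizer_coveringWeight`, `w₀ ∈ H(L⁺)` by ★ `iotaGG_one_mem_ratH`), and the inner section `F_s(x) = ∫ β₁(u) • f_s(w₀·(u·x)) dνN(u)` (a DEFINITION).  **`exists_middleTerm_datum`**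
packages all eleven letters in ★ I4 ED. 5's binder BYTES so the tie opens the datum block with ONE `obtain`.
HONEST LABEL.  Count-neutral helper; it retires nothing by itself: `HC_CM` is proved only modulo the 7 printed citations (2 remaining named inputs:
hLiu418 = `stmt-HodgeConjecture-24832`, h413 = `stmt-HodgeConjecture-24833`) until rung 0 closes.

## References
* [MoeglinWaldspurger1995] C. Mœglin, J.-L. Waldspurger, *Spectral decomposition and Eisenstein series* (1995), II.1.6–II.1.7.
* [GelbartPiatetskishapiroRallis1987] S. Gelbart, I. Piatetski-Shapiro, S. Rallis, *Explicit constructions of automorphic L-functions*, LNM 1254 (1987), Part A §1.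
* [KudlaRallis1994] S. Kudla, S. Rallis, Ann. of Math. 140 (1994), §2 (2.10)–(2.12).
-/

set_option autoImplicit false
set_option linter.dupNamespace false -- the mandated namespace repeats `HodgeConjecture.HodgeConjecture`

noncomputable section

open scoped Matrix ENNReal NNReal
open NumberField IsDedekindDomain MeasureTheory
open Literature.NumberTheory.Automorphic Literature.NumberTheory.Automorphic.UnitaryGroup
open Literature.NumberTheory.GelbartRogawski1991 Literature.NumberTheory.GelbartRogawski1991.GRConstruction
open Literature.NumberTheory.GelbartRogawski1991.AdaptedBlocks
open Literature.NumberTheory.K2Lit.SiegelDoubled Literature.MeasureTheory.Group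
open Summit.HodgeConjecture.HodgeConjecture.Cruxes.HLiu418.K2LiuSiegelMiddleTermStabilizerWeight (exists_stabilizer_coveringWeight)
open Summit.HodgeConjecture.HodgeConjecture.Cruxes.HLiu418.K2LiuSiegelDoubledLeviMatrix (exists_leviHom)
open Summit.HodgeConjecture.HodgeConjecture.Cruxes.HLiu418.K2LiuSiegelMiddleCellSortedPattern (exists_reflStd)
open Summit.HodgeConjecture.HodgeConjecture.Cruxes.HLiu418.K2LiuSiegelBruhatMiddleCellDelta (iotaGG_one_mem_ratH)

namespace Summit.HodgeConjecture.HodgeConjecture.Cruxes.HLiu418.K2LiuSiegelMiddleTermDatumLetters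

variable (L : Type) [Field L] [NumberField L] [IsCMField L]
variable {N M : ℕ} (e : Fin N × Fin M ≃ Fin 2)
  (dV : Fin N → L) (hdV : ∀ i, IsCMField.complexConj L (dV i) = dV i)
  (dW : Fin M → L) (hdW : ∀ i, IsCMField.complexConj L (dW i) = dW i)
variable [MeasurableSpace (unipDelta L e dV hdV dW hdW)] [BorelSpace (unipDelta L e dV hdV dW hdW)]

/-- **THE CONSTRUCTIBLE DATUM LETTERS OF ★ I4 ED. 5, IN ONE EXISTENTIAL.**  For the `n = 2` frame, a measure `νN` on `N_Δ(𝔸)` and a family `f` there are: the middle reflection `g₀`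
(`hg₀`, ★ `exists_reflStd`), the Levi chart `Λ` (continuous, block equation `hΛ`, ★ `exists_leviHom`), the stabiliser lattice `Γ₀` of `w₀ = ι(1, g₀ ⊗ 1)` with its membership law
`hΓ₀` and a `Γ₀`-covering weight `β₁` (★ p862779), and the inner section `F_s(x) = ∫ β₁(u) • f_s(w₀·(u·x)) dνN(u)` with its defining equation `hF` — exactly ★ p862751
`exists_middleTerm_package_of_standard_level`'s binders `hg₀ Λ hΛ Γ₀ hΓ₀ hΛc hβ₁ F hF`. [cite: MoeglinWaldspurger1995, II.1.6–II.1.7]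
[cite: GelbartPiatetskishapiroRallis1987, Part A §1] [cite: KudlaRallis1994, §2 (2.10)–(2.12)] -/
theorem exists_middleTerm_datum (hdV0 : ∀ i, dV i ≠ 0) (hdW0 : ∀ i, dW i ≠ 0) (νN : Measure (unipDelta L e dV hdV dW hdW))
    (f : ℂ → HA L e dV hdV dW hdW → ℂ) :
    ∃ (g₀ : UnitaryGroup.rationalPair (Fp L) L (IsCMField.complexConj L) N M (Matrix.diagonal dV) (Matrix.diagonal dW))
      (Λ : GL (Fin 2) (AdeleRing (𝓞 L) L) →* HA L e dV hdV dW hdW) (Γ₀ : Subgroup (unipDelta L e dV hdV dW hdW))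
      (β₁ : unipDelta L e dV hdV dW hdW → ℝ≥0∞) (F : ℂ → HA L e dV hdV dW hdW → ℂ),
      ((g₀ : GL (Fin N × Fin M) L) : Matrix (Fin N × Fin M) (Fin N × Fin M) L) = Matrix.diagonal (fun k => 1 - 2 * (![0, 1] : Fin 2 → L) (e k)) ∧
      Continuous Λ ∧
      (∀ g : GL (Fin 2) (AdeleRing (𝓞 L) L), blk L e dV hdV dW hdW (Λ g) =
        cayR (AdeleRing (𝓞 L) L) (Fin 2) * Matrix.fromBlocks (g : Matrix (Fin 2) (Fin 2) (AdeleRing (𝓞 L) L)) 0 0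
          (((gramR L e dV hdV dW hdW).map ((algebraMap L (AdeleRing (𝓞 L) L)).comp (algebraMap (Fp L) L)))⁻¹ *
            (((g⁻¹ : GL (Fin 2) (AdeleRing (𝓞 L) L)) : Matrix (Fin 2) (Fin 2) (AdeleRing (𝓞 L) L)).map
              (conjAdele (Fp L) L (IsCMField.complexConj L)))ᵀ *
            (gramR L e dV hdV dW hdW).map ((algebraMap L (AdeleRing (𝓞 L) L)).comp (algebraMap (Fp L) L))) *
          cayRinv (AdeleRing (𝓞 L) L) (Fin 2)) ∧
      (∀ u : unipDelta L e dV hdV dW hdW, u ∈ Γ₀ ↔ (u : HA L e dV hdV dW hdW) ∈ ratH L e dV hdV dW hdW ∧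
        IsSiegelDelta L e dV hdV dW hdW (iotaGG L e dV hdV dW hdW (1, UnitaryGroup.rationalPairToAdelic (Fp L) L (IsCMField.complexConj L) N M (Matrix.diagonal dV) (Matrix.diagonal dW) g₀) * (u : HA L e dV hdV dW hdW) * (iotaGG L e dV hdV dW hdW (1, UnitaryGroup.rationalPairToAdelic (Fp L) L (IsCMField.complexConj L) N M (Matrix.diagonal dV) (Matrix.diagonal dW) g₀))⁻¹)) ∧
      IsCoveringWeight Γ₀ β₁ ∧
      (∀ (s : ℂ) (x : HA L e dV hdV dW hdW), F s x = ∫ u, (β₁ u).toReal • f s (iotaGG L e dV hdV dW hdW (1, UnitaryGroup.rationalPairToAdelic (Fp L) L (IsCMField.complexConj L) N M (Matrix.diagonal dV) (Matrix.diagonal dW) g₀) * ((u : HA L e dV hdV dW hdW) * x)) ∂νN) := by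
  obtain ⟨g₀, hg₀, -⟩ := exists_reflStd L e dV dW
  obtain ⟨Λ, hΛc, hΛ⟩ := exists_leviHom L e dV hdV dW hdW hdV0 hdW0
  obtain ⟨Γ₀, β₁, hΓ₀, hβ₁⟩ := exists_stabilizer_coveringWeight L e dV hdV dW hdW
    (⟨iotaGG L e dV hdV dW hdW (1, UnitaryGroup.rationalPairToAdelic (Fp L) L (IsCMField.complexConj L) N M (Matrix.diagonal dV) (Matrix.diagonal dW) g₀),
      iotaGG_one_mem_ratH L e dV hdV dW hdW g₀⟩ : ratH L e dV hdV dW hdW)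
  exact ⟨g₀, Λ, Γ₀, β₁, _, hg₀, hΛc, hΛ, hΓ₀, hβ₁, fun _ _ => rfl⟩

end Summit.HodgeConjecture.HodgeConjecture.Cruxes.HLiu418.K2LiuSiegelMiddleTermDatumLetters

end
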